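import Summits.AtomisticToContinuum.Crystallization.Theorems.HullExactificationCascadeRobustBarlowTemplateHoneycombContinuous
import Summits.AtomisticToContinuum.Crystallization.Theorems.HullExactificationCascadeRobustBarlowTemplateInjectiveFarVertex
import Mathlib.Analysis.Convex.Basic

/-!
# Cell-level estimates for `injective_starApprox` (line `registered`, crux `RobustBarlowTemplate`, stmt-AtomisticToContinuum-12088)

Toward the registered stub `develop_injective` (the STAR ESTIMATE `injective_starApprox`): the
piecewise-affine extension `F = plExtend s (Ψ ∘ siteAt s)` of a development `Ψ` with `LocSim s Ψ`
is, on every closed cell of the refined Barlow honeycomb having the site `v` as a vertex,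
`(27/40) l_v`-approximately the similarity `l_v • A_v` of `LocSim` at `v`.

## Contents
* `injective_forms` — the six linear forms `Δa, Δb, Δθ, Δa+Δb+Δθ, Δb+Δθ, Δa+Δθ` (and `Δa+Δb`)
  are bounded by `√2` times the skew norm `√(Σ Δᵢ² + Σ_{i<j} Δᵢ Δⱼ)`;
* `injective_skewSite_eq_iff`, `injective_site_mem`, `injective_sqdist_site`,
  `injective_site_dist_eq_one`, `injective_site_dist_le_one` — sites of a slab in skew coordinates;
* `injective_far_CD`, `injective_far_DC` — the FAR-VERTEX BOUND `61/190 · l` for the two ends of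
  the diagonal `C–D` of the octahedron of a prism (from `injective_farVertex`,
  `injective_scaleRatio` with `P = A`, `Q = F`, `X = B`);
* `injective_comb_core` — the algebraic heart: a barycentric difference formula and the estimate
  `‖F z − F z' − l A (z − z')‖ ≤ (3/2) (Σ ηₘ) ‖z − z'‖` from vertex errors `ηₘ` and weight
  gradients `≤ √2 ≤ 3/2`;
* `injective_toSkew_affine` — the skew coordinates are affine;
* `injective_good_of` — from the data of a closed cell (membership predicate, weights, vertex
  index triples and their geometry) to the CELL PACKAGE used by the assembly: the cell is closed
  and convex, every hat function is `√2`-Lipschitz on it, and the star estimate holds on it for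
  every vertex detected by a non-vanishing hat function;
* `injective_farDiagonal` — registered anchor (explicit form of `injective_far_CD`).
-/

noncomputable section

namespace Summit.AtomisticToContinuum.Crystallization.Theorems.HullExactificationCascadeRobustBarlowTemplate

open Literature.MathematicalPhysics.StatisticalMechanics

/-- Euclidean `3`-space. -/
local notation "E3" => EuclideanSpace ℝ (Fin 3)

/-! ## Linear forms against the skew norm -/

/-- The squares of the linear forms `p, q, r, p+q+r, p+q, p+r, q+r` are at most twice the Gram
form `p² + q² + r² + pq + pr + qr` of the skew frame. -/
theorem injective_forms (p q r : ℝ) :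
    p ^ 2 ≤ 2 * (p ^ 2 + q ^ 2 + r ^ 2 + p * q + p * r + q * r) ∧
    q ^ 2 ≤ 2 * (p ^ 2 + q ^ 2 + r ^ 2 + p * q + p * r + q * r) ∧
    r ^ 2 ≤ 2 * (p ^ 2 + q ^ 2 + r ^ 2 + p * q + p * r + q * r) ∧
    (p + q + r) ^ 2 ≤ 2 * (p ^ 2 + q ^ 2 + r ^ 2 + p * q + p * r + q * r) ∧
    (p + q) ^ 2 ≤ 2 * (p ^ 2 + q ^ 2 + r ^ 2 + p * q + p * r + q * r) ∧
    (p + r) ^ 2 ≤ 2 * (p ^ 2 + q ^ 2 + r ^ 2 + p * q + p * r + q * r) ∧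
    (q + r) ^ 2 ≤ 2 * (p ^ 2 + q ^ 2 + r ^ 2 + p * q + p * r + q * r) := by
  refine ⟨?_, ?_, ?_, ?_, ?_, ?_, ?_⟩
  · nlinarith [sq_nonneg (p + q + r), sq_nonneg q, sq_nonneg r]
  · nlinarith [sq_nonneg (p + q + r), sq_nonneg p, sq_nonneg r]
  · nlinarith [sq_nonneg (p + q + r), sq_nonneg p, sq_nonneg q]
  · nlinarith [sq_nonneg p, sq_nonneg q, sq_nonneg r]
  · nlinarith [sq_nonneg (p + r), sq_nonneg (q + r)]
  · nlinarith [sq_nonneg (p + q), sq_nonneg (q + r)]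
  · nlinarith [sq_nonneg (p + q), sq_nonneg (p + r)]

/-! ## Sites of a slab -/

/-- Two sites of slab `k` given by integer skew coordinates coincide iff the coordinates do. -/
theorem injective_skewSite_eq_iff {s : ℤ → ℤ} {k : ℤ} (hsk : s k = 1 ∨ s k = -1)
    (p q r p' q' r' : ℤ) :
    skewSite s k p q r = skewSite s k p' q' r' ↔ p = p' ∧ q = q' ∧ r = r' := by
  simp only [skewSite, Prod.mk.injEq, add_right_inj]
  rcases hsk with h | h <;> simp [h] <;> tauto

/-- Every site is a point of the ideal stacking. -/
theorem injective_site_mem (s : ℤ → ℤ) (t : ℤ × ℤ × ℤ) : siteAt s t ∈ idealStacking s :=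
  barlowPos_mem _ _ _

/-- Squared distance of two sites of slab `k` in integer skew coordinates. -/
theorem injective_sqdist_site {s : ℤ → ℤ} (hs : IsHaggSeq s) (k p q r p' q' r' : ℤ)
    (hr : r = 0 ∨ r = 1) (hr' : r' = 0 ∨ r' = 1) :
    dist (siteAt s (skewSite s k p q r)) (siteAt s (skewSite s k p' q' r')) ^ 2 =
      ((p : ℝ) - p') ^ 2 + ((q : ℝ) - q') ^ 2 + ((r : ℝ) - r') ^ 2 + ((p : ℝ) - p') * ((q : ℝ) - q') +
        ((p : ℝ) - p') * ((r : ℝ) - r') + ((q : ℝ) - q') * ((r : ℝ) - r') := by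
  rw [honeycomb_siteAt_skewSite s k p q r hr hs, honeycomb_siteAt_skewSite s k p' q' r' hr' hs,
    honeycomb_sqdist_ofSkew s k (hs k)]
  simp

/-- Two sites of slab `k` at skew-Gram distance `1` are at distance `1`. -/
theorem injective_site_dist_eq_one {s : ℤ → ℤ} (hs : IsHaggSeq s) (k p q r p' q' r' : ℤ)
    (hr : r = 0 ∨ r = 1) (hr' : r' = 0 ∨ r' = 1)
    (hG : ((p : ℝ) - p') ^ 2 + ((q : ℝ) - q') ^ 2 + ((r : ℝ) - r') ^ 2 + ((p : ℝ) - p') * ((q : ℝ) - q') +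
        ((p : ℝ) - p') * ((r : ℝ) - r') + ((q : ℝ) - q') * ((r : ℝ) - r') = 1) :
    dist (siteAt s (skewSite s k p q r)) (siteAt s (skewSite s k p' q' r')) = 1 :=
  (pow_eq_one_iff_of_nonneg dist_nonneg two_ne_zero).1 ((injective_sqdist_site hs k p q r p' q' r' hr hr').trans hG)

/-- Two sites of slab `k` at skew-Gram distance `1` are within distance `1`. -/
theorem injective_site_dist_le_one {s : ℤ → ℤ} (hs : IsHaggSeq s) (k p q r p' q' r' : ℤ)
    (hr : r = 0 ∨ r = 1) (hr' : r' = 0 ∨ r' = 1)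
    (hG : ((p : ℝ) - p') ^ 2 + ((q : ℝ) - q') ^ 2 + ((r : ℝ) - r') ^ 2 + ((p : ℝ) - p') * ((q : ℝ) - q') +
        ((p : ℝ) - p') * ((r : ℝ) - r') + ((q : ℝ) - q') * ((r : ℝ) - r') = 1) :
    dist (siteAt s (skewSite s k p q r)) (siteAt s (skewSite s k p' q' r')) ≤ 1 :=
  (injective_site_dist_eq_one hs k p q r p' q' r' hr hr' hG).le

/-- The octahedron identity `D = A + F - C` of a prism (`A = (1,0,0)`, `F = (0,1,1)`,
`C = (1,1,0)`, `D = (0,0,1)` relative to `(i, j)`). -/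
theorem injective_site_D_eq {s : ℤ → ℤ} (hs : IsHaggSeq s) (k i j : ℤ) :
    siteAt s (skewSite s k i j 1) =
      siteAt s (skewSite s k (i + 1) j 0) + siteAt s (skewSite s k i (j + 1) 1) -
        siteAt s (skewSite s k (i + 1) (j + 1) 0) := by
  rw [honeycomb_siteAt_skewSite s k i j 1 (Or.inr rfl) hs,
    honeycomb_siteAt_skewSite s k (i + 1) j 0 (Or.inl rfl) hs,
    honeycomb_siteAt_skewSite s k i (j + 1) 1 (Or.inr rfl) hs,
    honeycomb_siteAt_skewSite s k (i + 1) (j + 1) 0 (Or.inl rfl) hs]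
  simp only [ofSkew, Matrix.cons_val_zero, Matrix.cons_val_one, Matrix.cons_val]
  push_cast
  module

/-! ## The far-vertex bound on the diagonal `C–D` -/

/-- FAR-VERTEX BOUND at `C`: with the `LocSim` data `(A, l)` at the vertex `C = (1,1,0)` of prism
`(k, i, j)`, the affine model at `C` predicts `Ψ` at the opposite vertex `D = (0,0,1)` of the
octahedron up to `61/190 · l` (`= (21/95 + 1/10) l`: `injective_farVertex` with `P = A`, `Q = F`,
`X = B` and `injective_scaleRatio` for the scale at `B`). -/
theorem injective_far_CD {s : ℤ → ℤ} (hs : IsHaggSeq s) {Ψ : E3 → E3} (hL : LocSim s Ψ)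
    (k i j : ℤ) (A : E3 →ₗᵢ[ℝ] E3) (l : ℝ) (hl : 0 < l)
    (hcl : ∀ q ∈ idealStacking s, dist q (siteAt s (skewSite s k (i + 1) (j + 1) 0)) ≤ 1 →
      dist (Ψ q) (Ψ (siteAt s (skewSite s k (i + 1) (j + 1) 0)) +
        l • A (q - siteAt s (skewSite s k (i + 1) (j + 1) 0))) ≤ 1 / 20 * l) :
    dist (Ψ (siteAt s (skewSite s k i j 1)))
      (Ψ (siteAt s (skewSite s k (i + 1) (j + 1) 0)) +
        l • A (siteAt s (skewSite s k i j 1) - siteAt s (skewSite s k (i + 1) (j + 1) 0))) ≤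
      61 / 190 * l := by
  obtain ⟨Ax, lx, hlx, hclX⟩ := hL (siteAt s (skewSite s k i (j + 1) 0)) (injective_site_mem s _)
  have h0 : (0 : ℤ) = 0 ∨ (0 : ℤ) = 1 := Or.inl rfl
  have h1 : (1 : ℤ) = 0 ∨ (1 : ℤ) = 1 := Or.inr rfl
  have hXv : dist (siteAt s (skewSite s k i (j + 1) 0)) (siteAt s (skewSite s k (i + 1) (j + 1) 0)) = 1 :=
    injective_site_dist_eq_one hs k _ _ _ _ _ _ h0 h0 (by push_cast; ring)
  have hfar := injective_farVertex s Ψ (siteAt s (skewSite s k (i + 1) (j + 1) 0))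
    (siteAt s (skewSite s k i j 1)) (siteAt s (skewSite s k (i + 1) j 0))
    (siteAt s (skewSite s k i (j + 1) 1)) (siteAt s (skewSite s k i (j + 1) 0))
    (injective_site_mem s _) (injective_site_mem s _) (injective_site_mem s _)
    (injective_site_mem s _) (injective_site_mem s _)
    (injective_site_dist_le_one hs k _ _ _ _ _ _ h0 h0 (by push_cast; ring))
    (injective_site_dist_le_one hs k _ _ _ _ _ _ h1 h0 (by push_cast; ring))
    hXv.le (by rw [dist_comm]; exact hXv.le)
    (injective_site_dist_le_one hs k _ _ _ _ _ _ h0 h0 (by push_cast; ring))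
    (injective_site_dist_le_one hs k _ _ _ _ _ _ h1 h0 (by push_cast; ring))
    (injective_site_dist_le_one hs k _ _ _ _ _ _ h1 h0 (by push_cast; ring))
    (injective_site_D_eq hs k i j) A Ax l lx hl hlx hcl hclX
  have hratio := injective_scaleRatio s Ψ (siteAt s (skewSite s k (i + 1) (j + 1) 0))
    (siteAt s (skewSite s k i (j + 1) 0)) (injective_site_mem s _) (injective_site_mem s _) hXv
    A Ax l lx hl hlx hcl hclX
  linarith

/-- FAR-VERTEX BOUND at `D`: with the `LocSim` data `(A, l)` at `D = (0,0,1)`, the affine model at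
`D` predicts `Ψ` at `C = (1,1,0)` up to `61/190 · l`. -/
theorem injective_far_DC {s : ℤ → ℤ} (hs : IsHaggSeq s) {Ψ : E3 → E3} (hL : LocSim s Ψ)
    (k i j : ℤ) (A : E3 →ₗᵢ[ℝ] E3) (l : ℝ) (hl : 0 < l)
    (hcl : ∀ q ∈ idealStacking s, dist q (siteAt s (skewSite s k i j 1)) ≤ 1 →
      dist (Ψ q) (Ψ (siteAt s (skewSite s k i j 1)) + l • A (q - siteAt s (skewSite s k i j 1))) ≤
        1 / 20 * l) :
    dist (Ψ (siteAt s (skewSite s k (i + 1) (j + 1) 0)))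
      (Ψ (siteAt s (skewSite s k i j 1)) +
        l • A (siteAt s (skewSite s k (i + 1) (j + 1) 0) - siteAt s (skewSite s k i j 1))) ≤
      61 / 190 * l := by
  obtain ⟨Ax, lx, hlx, hclX⟩ := hL (siteAt s (skewSite s k i (j + 1) 0)) (injective_site_mem s _)
  have h0 : (0 : ℤ) = 0 ∨ (0 : ℤ) = 1 := Or.inl rfl
  have h1 : (1 : ℤ) = 0 ∨ (1 : ℤ) = 1 := Or.inr rfl
  have hXv : dist (siteAt s (skewSite s k i (j + 1) 0)) (siteAt s (skewSite s k i j 1)) = 1 :=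
    injective_site_dist_eq_one hs k _ _ _ _ _ _ h0 h1 (by push_cast; ring)
  have hCeq : siteAt s (skewSite s k (i + 1) (j + 1) 0) =
      siteAt s (skewSite s k (i + 1) j 0) + siteAt s (skewSite s k i (j + 1) 1) -
        siteAt s (skewSite s k i j 1) := by
    rw [injective_site_D_eq hs k i j]; abel
  have hfar := injective_farVertex s Ψ (siteAt s (skewSite s k i j 1))
    (siteAt s (skewSite s k (i + 1) (j + 1) 0)) (siteAt s (skewSite s k (i + 1) j 0))
    (siteAt s (skewSite s k i (j + 1) 1)) (siteAt s (skewSite s k i (j + 1) 0))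
    (injective_site_mem s _) (injective_site_mem s _) (injective_site_mem s _)
    (injective_site_mem s _) (injective_site_mem s _)
    (injective_site_dist_le_one hs k _ _ _ _ _ _ h0 h1 (by push_cast; ring))
    (injective_site_dist_le_one hs k _ _ _ _ _ _ h1 h1 (by push_cast; ring))
    hXv.le (by rw [dist_comm]; exact hXv.le)
    (injective_site_dist_le_one hs k _ _ _ _ _ _ h0 h0 (by push_cast; ring))
    (injective_site_dist_le_one hs k _ _ _ _ _ _ h1 h0 (by push_cast; ring))
    (injective_site_dist_le_one hs k _ _ _ _ _ _ h0 h0 (by push_cast; ring))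
    hCeq A Ax l lx hl hlx hcl hclX
  have hratio := injective_scaleRatio s Ψ (siteAt s (skewSite s k i j 1))
    (siteAt s (skewSite s k i (j + 1) 0)) (injective_site_mem s _) (injective_site_mem s _) hXv
    A Ax l lx hl hlx hcl hclX
  linarith

/-! ## The algebraic core of the cell estimate -/

/-- THE CELL ESTIMATE, abstractly: if `F z = Σ ωₘ Ψ(Vₘ)`, `z = Σ ωₘ Vₘ`, `Σ ωₘ = 1` (and the same
for `z'` with weights `ω'`), the weight differences are bounded by `√2 ‖z − z'‖`, and the vertex
values are `ηₘ`-close to the affine model `Ψ v + l A (· − v)`, then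
`‖F z − F z' − l A (z − z')‖ ≤ (3/2) (Σ ηₘ) ‖z − z'‖`. -/
theorem injective_comb_core (z z' Fz Fz' v : E3) (ω ω' η : Fin 4 → ℝ) (V : Fin 4 → E3)
    (Ψ : E3 → E3) (A : E3 →ₗᵢ[ℝ] E3) (l : ℝ)
    (hz : Fz = ∑ m, ω m • Ψ (V m)) (hz' : Fz' = ∑ m, ω' m • Ψ (V m))
    (hb : ∑ m, ω m • V m = z) (hb' : ∑ m, ω' m • V m = z')
    (hs : ∑ m, ω m = 1) (hs' : ∑ m, ω' m = 1)
    (hgrad : ∀ m, (ω m - ω' m) ^ 2 ≤ 2 * ‖z - z'‖ ^ 2)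
    (hη : ∀ m, ‖Ψ (V m) - (Ψ v + l • A (V m - v))‖ ≤ η m) :
    ‖Fz - Fz' - l • A (z - z')‖ ≤ 3 / 2 * (∑ m, η m) * ‖z - z'‖ := by
  subst hz hz'
  have key : (∑ m, ω m • Ψ (V m)) - (∑ m, ω' m • Ψ (V m)) - l • A (z - z') =
      ∑ m, (ω m - ω' m) • (Ψ (V m) - (Ψ v + l • A (V m - v))) := by
    rw [← hb, ← hb']
    rw [Fin.sum_univ_four] at hs hs'
    have e3 : ω 3 = 1 - ω 0 - ω 1 - ω 2 := by linarith
    have e3' : ω' 3 = 1 - ω' 0 - ω' 1 - ω' 2 := by linarith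
    simp only [Fin.sum_univ_four, LinearIsometry.map_add, LinearIsometry.map_sub,
      LinearIsometry.map_smul, smul_add, smul_sub, e3, e3']
    module
  rw [key]
  have hd : ∀ m, |ω m - ω' m| ≤ 3 / 2 * ‖z - z'‖ := fun m =>
    abs_le_of_sq_le_sq (by nlinarith [hgrad m, sq_nonneg ‖z - z'‖]) (by positivity)
  calc ‖∑ m, (ω m - ω' m) • (Ψ (V m) - (Ψ v + l • A (V m - v)))‖
      ≤ ∑ m, ‖(ω m - ω' m) • (Ψ (V m) - (Ψ v + l • A (V m - v)))‖ := norm_sum_le _ _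
    _ = ∑ m, |ω m - ω' m| * ‖Ψ (V m) - (Ψ v + l • A (V m - v))‖ := by
        simp only [norm_smul, Real.norm_eq_abs]
    _ ≤ ∑ m, 3 / 2 * ‖z - z'‖ * η m :=
        Finset.sum_le_sum fun m _ => mul_le_mul (hd m) (hη m) (norm_nonneg _) (by positivity)
    _ = 3 / 2 * (∑ m, η m) * ‖z - z'‖ := by rw [← Finset.mul_sum]; ring

/-! ## From cell data to the cell package -/

/-- The skew coordinates of a slab are affine functions of the point. -/
theorem injective_toSkew_affine (s : ℤ → ℤ) (k : ℤ) (x y : E3) (p q : ℝ) (hpq : p + q = 1)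
    (n : Fin 3) : toSkew s k (p • x + q • y) n = p * toSkew s k x n + q * toSkew s k y n := by
  obtain rfl : q = 1 - p := by linarith
  have hh := honeycomb_hB_ne_zero
  fin_cases n <;> simp [toSkew] <;> field_simp <;> ring

/-- THE CELL PACKAGE from cell data.  A closed cell `C` of prism `(k, i, j)` is given by a
membership predicate `Pred` in the local skew coordinates, affine weights `w` and vertex index
triples `T` such that `plExtend` is `Σ wₘ • g(Tₘ)` on `C` (the formulas of
`…HoneycombContinuousA`), the weights are barycentric for the vertex sites with gradients bounded
by `√2`, the `Tₘ` are distinct, and the VERTEX GEOMETRY holds: seen from any vertex `T m₀` with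
`LocSim` data `(A, l)` there, the error of the affine model at the vertex `T m` is at most
`M m₀ m · l`, with row sums of `M` at most `9/20`.  Then `C` is closed and
convex, every hat function is `√2`-Lipschitz on `C`, and for every site `t₀` whose hat function
does not vanish somewhere on `C` (so `t₀` is a vertex of `C`) the star estimate with constant
`27/40 · l` holds on `C`. -/
theorem injective_good_of {s : ℤ → ℤ} (hs : IsHaggSeq s) (k i j : ℤ) (Pred : ℝ → ℝ → ℝ → Prop)
    (w : Fin 4 → ℝ → ℝ → ℝ → ℝ) (T : Fin 4 → ℤ × ℤ × ℤ) (C : Set E3)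
    (hC : C = {x : E3 | Pred (toSkew s k x 0 - i) (toSkew s k x 1 - j) (toSkew s k x 2)})
    (hclosed : IsClosed C)
    (hconv : ∀ a b θ a' b' θ' p q : ℝ, 0 ≤ p → 0 ≤ q → p + q = 1 → Pred a b θ → Pred a' b' θ' →
      Pred (p * a + q * a') (p * b + q * b') (p * θ + q * θ'))
    (hform : ∀ (W : Type) [AddCommGroup W] [Module ℝ W] (g : ℤ × ℤ × ℤ → W) (a b θ : ℝ),
      Pred a b θ → plExtend s g (ofSkew s k ![(i : ℝ) + a, (j : ℝ) + b, θ]) = ∑ m, w m a b θ • g (T m))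
    (hbary : ∀ a b θ : ℝ, ∑ m, w m a b θ • siteAt s (T m) = ofSkew s k ![(i : ℝ) + a, (j : ℝ) + b, θ])
    (hsum : ∀ a b θ : ℝ, ∑ m, w m a b θ = 1)
    (hgrad : ∀ (m : Fin 4) (a b θ a' b' θ' : ℝ), (w m a b θ - w m a' b' θ') ^ 2 ≤
      2 * dist (ofSkew s k ![(i : ℝ) + a, (j : ℝ) + b, θ]) (ofSkew s k ![(i : ℝ) + a', (j : ℝ) + b', θ']) ^ 2)
    (hT : ∀ m m' : Fin 4, T m = T m' → m = m') (M : Fin 4 → Fin 4 → ℝ)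
    (hM : ∀ m₀, ∑ m, M m₀ m ≤ 9 / 20)
    (hgeom : ∀ Ψ : E3 → E3, LocSim s Ψ → ∀ (m₀ : Fin 4) (A : E3 →ₗᵢ[ℝ] E3) (l : ℝ), 0 < l →
      (∀ q ∈ idealStacking s, dist q (siteAt s (T m₀)) ≤ 1 →
        dist (Ψ q) (Ψ (siteAt s (T m₀)) + l • A (q - siteAt s (T m₀))) ≤ 1 / 20 * l) →
      ∀ m, ‖Ψ (siteAt s (T m)) - (Ψ (siteAt s (T m₀)) + l • A (siteAt s (T m) - siteAt s (T m₀)))‖ ≤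
        M m₀ m * l) :
    IsClosed C ∧ Convex ℝ C ∧
    (∀ t₀ : ℤ × ℤ × ℤ, ∀ z ∈ C, ∀ z' ∈ C,
      |plExtend s (fun t => if t = t₀ then (1 : ℝ) else 0) z -
        plExtend s (fun t => if t = t₀ then (1 : ℝ) else 0) z'| ≤ Real.sqrt 2 * ‖z - z'‖) ∧
    (∀ Ψ : E3 → E3, LocSim s Ψ → ∀ (t₀ : ℤ × ℤ × ℤ) (A : E3 →ₗᵢ[ℝ] E3) (l : ℝ), 0 < l →
      (∀ q ∈ idealStacking s, dist q (siteAt s t₀) ≤ 1 →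
        dist (Ψ q) (Ψ (siteAt s t₀) + l • A (q - siteAt s t₀)) ≤ 1 / 20 * l) →
      (∃ y ∈ C, plExtend s (fun t => if t = t₀ then (1 : ℝ) else 0) y ≠ 0) →
      ∀ z ∈ C, ∀ z' ∈ C, ‖plExtend s (fun t => Ψ (siteAt s t)) z -
        plExtend s (fun t => Ψ (siteAt s t)) z' - l • A (z - z')‖ ≤ 27 / 40 * l * ‖z - z'‖) := by
  -- points of `C` in local skew coordinates
  have hmem : ∀ z ∈ C, ∃ a b θ : ℝ, Pred a b θ ∧ z = ofSkew s k ![(i : ℝ) + a, (j : ℝ) + b, θ] := by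
    intro z hz
    rw [hC] at hz
    exact ⟨_, _, _, hz, (honeycomb_ofSkew_shift (hs k) z i j).symm⟩
  -- the hat function of `t₀` on `C`: a single weight, or zero
  have hhat : ∀ (t₀ : ℤ × ℤ × ℤ) (a b θ : ℝ), Pred a b θ →
      ((∃ m₀, T m₀ = t₀ ∧ plExtend s (fun t => if t = t₀ then (1 : ℝ) else 0)
        (ofSkew s k ![(i : ℝ) + a, (j : ℝ) + b, θ]) = w m₀ a b θ) ∨
      ((∀ m, T m ≠ t₀) ∧ plExtend s (fun t => if t = t₀ then (1 : ℝ) else 0)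
        (ofSkew s k ![(i : ℝ) + a, (j : ℝ) + b, θ]) = 0)) := by
    intro t₀ a b θ hP
    rw [hform ℝ (fun t => if t = t₀ then (1 : ℝ) else 0) a b θ hP]
    by_cases hex : ∃ m₀, T m₀ = t₀
    · obtain ⟨m₀, hm₀⟩ := hex
      refine Or.inl ⟨m₀, hm₀, ?_⟩
      rw [Finset.sum_eq_single m₀]
      · simp [hm₀]
      · intro m _ hm
        have : T m ≠ t₀ := fun h => hm (hT _ _ (h.trans hm₀.symm))
        simp [this]
      · simp
    · push Not at hex
      refine Or.inr ⟨hex, Finset.sum_eq_zero fun m _ => ?_⟩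
      simp [hex m]
  refine ⟨hclosed, ?_, ?_, ?_⟩
  · -- convexity
    intro x hx y hy p q hp hq hpq
    rw [hC] at hx hy ⊢
    simp only [Set.mem_setOf_eq] at hx hy ⊢
    have e := injective_toSkew_affine s k x y p q hpq
    have h := hconv _ _ _ _ _ _ p q hp hq hpq hx hy
    convert h using 2
    · rw [e]; linear_combination (i : ℝ) * hpq
    · rw [e]; linear_combination (j : ℝ) * hpq
    · rw [e]
  · -- the hat functions are `√2`-Lipschitz on `C`
    intro t₀ z hz z' hz'
    obtain ⟨a, b, θ, hP, rfl⟩ := hmem z hz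
    obtain ⟨a', b', θ', hP', rfl⟩ := hmem z' hz'
    have hnn : 0 ≤ Real.sqrt 2 *
        ‖ofSkew s k ![(i : ℝ) + a, (j : ℝ) + b, θ] - ofSkew s k ![(i : ℝ) + a', (j : ℝ) + b', θ']‖ := by
      positivity
    rcases hhat t₀ a b θ hP with ⟨m₀, hm₀, h1⟩ | ⟨hne, h1⟩ <;>
      rcases hhat t₀ a' b' θ' hP' with ⟨m₁, hm₁, h2⟩ | ⟨hne', h2⟩
    · obtain rfl : m₀ = m₁ := hT _ _ (hm₀.trans hm₁.symm)
      rw [h1, h2]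
      refine abs_le_of_sq_le_sq ?_ hnn
      rw [mul_pow, Real.sq_sqrt (by norm_num), ← dist_eq_norm]
      exact hgrad m₀ a b θ a' b' θ'
    · exact absurd hm₀ (hne' m₀)
    · exact absurd hm₁ (hne m₁)
    · rw [h1, h2, sub_self, abs_zero]; exact hnn
  · -- the star estimate on `C`
    rintro Ψ hL t₀ A l hl hcl ⟨y, hy, hy0⟩ z hz z' hz'
    obtain ⟨a₀, b₀, θ₀, hP₀, rfl⟩ := hmem y hy
    obtain ⟨m₀, rfl⟩ : ∃ m₀, T m₀ = t₀ := by
      rcases hhat t₀ a₀ b₀ θ₀ hP₀ with ⟨m₀, hm₀, -⟩ | ⟨-, h0⟩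
      · exact ⟨m₀, hm₀⟩
      · exact absurd h0 hy0
    have hη := hgeom Ψ hL m₀ A l hl hcl
    have hηs : ∑ m, M m₀ m * l ≤ 9 / 20 * l := by
      rw [← Finset.sum_mul]
      exact mul_le_mul_of_nonneg_right (hM m₀) hl.le
    obtain ⟨a, b, θ, hP, rfl⟩ := hmem z hz
    obtain ⟨a', b', θ', hP', rfl⟩ := hmem z' hz'
    have h := injective_comb_core (ofSkew s k ![(i : ℝ) + a, (j : ℝ) + b, θ])
      (ofSkew s k ![(i : ℝ) + a', (j : ℝ) + b', θ']) _ _ (siteAt s (T m₀)) (fun m => w m a b θ)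
      (fun m => w m a' b' θ') (fun m => M m₀ m * l) (fun m => siteAt s (T m)) Ψ A l
      (hform E3 (fun t => Ψ (siteAt s t)) a b θ hP) (hform E3 (fun t => Ψ (siteAt s t)) a' b' θ' hP')
      (hbary a b θ) (hbary a' b' θ') (hsum a b θ) (hsum a' b' θ')
      (fun m => by rw [← dist_eq_norm]; exact hgrad m a b θ a' b' θ') hη
    refine h.trans ?_
    have hn := norm_nonneg (ofSkew s k ![(i : ℝ) + a, (j : ℝ) + b, θ] - ofSkew s k ![(i : ℝ) + a', (j : ℝ) + b', θ'])
    nlinarith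

/-- SUB-GOAL (registered anchor `injective_farDiagonal`): the far-vertex bound `61/190 · l` across
the diagonal `C–D` of the octahedron of prism `(k, i, j)`, seen from `C` (explicit form of
`injective_far_CD`). -/
theorem injective_farDiagonal : ∀ (s : ℤ → ℤ), IsHaggSeq s → ∀ (Ψ : E3 → E3), LocSim s Ψ → ∀ (k i j : ℤ) (A : E3 →ₗᵢ[ℝ] E3) (l : ℝ), 0 < l → (∀ q ∈ idealStacking s, dist q (siteAt s (skewSite s k (i + 1) (j + 1) 0)) ≤ 1 → dist (Ψ q) (Ψ (siteAt s (skewSite s k (i + 1) (j + 1) 0)) + l • A (q - siteAt s (skewSite s k (i + 1) (j + 1) 0))) ≤ 1 / 20 * l) → dist (Ψ (siteAt s (skewSite s k i j 1))) (Ψ (siteAt s (skewSite s k (i + 1) (j + 1) 0)) + l • A (siteAt s (skewSite s k i j 1) - siteAt s (skewSite s k (i + 1) (j + 1) 0))) ≤ 61 / 190 * l :=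
  fun _ hs _ hL k i j A l hl hcl => injective_far_CD hs hL k i j A l hl hcl

end Summit.AtomisticToContinuum.Crystallization.Theorems.HullExactificationCascadeRobustBarlowTemplate

end
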